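import Summits.NavierStokesRegularity.NavierStokesRegularity.Theses.AxisymmetricExtremality
import Summits.NavierStokesRegularity.NavierStokesRegularity.Theorems.AxisymmetricExtremalityMinimalDatumPFoldThresholdFinite
import Summits.NavierStokesRegularity.NavierStokesRegularity.Theorems.AxisymmetricExtremalityMinimalDatumPFoldNotAeZero
import Summits.NavierStokesRegularity.NavierStokesRegularity.Theorems.AxisymmetricExtremalityMinimalDatumPFoldRecentre
import Summits.NavierStokesRegularity.NavierStokesRegularity.Theorems.AxisymmetricExtremalityMinimalDatumPFoldAeToExact
import Summits.NavierStokesRegularity.NavierStokesRegularity.Theorems.AxisymmetricExtremalityMinimalDatumPFoldSymmetryDefectInLimit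
import Summits.NavierStokesRegularity.NavierStokesRegularity.Theorems.AxisymmetricExtremalityPFoldToAxisymmetric
import Summits.NavierStokesRegularity.NavierStokesRegularity.Theorems.AxisymmetricExtremalityMinimalDatumPFoldUniformRegularity
import Summits.NavierStokesRegularity.NavierStokesRegularity.Theorems.AxisymmetricExtremalityMinimalDatumPFoldConcentrationWeakLimitBlowup
import Summits.NavierStokesRegularity.NavierStokesRegularity.Theorems.AxisymmetricExtremalityMinimalDatumPFoldConcentrationNearMinimalLimit
import Summits.NavierStokesRegularity.NavierStokesRegularity.Theorems.AxisymmetricExtremalityMinimalDatumPFoldBranchOfAxisymMinimalDatum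
import Literature.Analysis.FluidPDE.RusinSverakLerayStability
import Literature.Analysis.FluidPDE.RusinSverakCompactnessProofs

/-!
# Line `Sketch` (idea `subthreshold-dissipation-branch`) — crux `MinimalDatumPFold` (stmt-NavierStokesRegularity-15452)

Lead c2 (prover-line-stmt-NavierStokesRegularity-15452-c2-0), 2026-08-17. Skeleton of the crux-ideate r1/k1
line (`Ideas/subthreshold-dissipation-branch.md`; its evidence file `…-Sketch.lean` composed
`ThresholdFiniteOfClayFailure → AxisymSizeExtraction → AxisymSubthresholdSizeUnbounded → MinimalDatumPFold`),
RE-TYPED by the lead so that the extraction is provable NOW from the tree's discharged Rusin–Šverák / CKN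
cone: the card measured the "size" of a sub-threshold (hence GLOBAL) axisymmetric Kato solution by its
`L⁵((0,∞)×ℝ³)` norm, whose extraction lemma needs the `Ḣ^{1/2}` profile decomposition, `L⁵`-stability and
the Gallagher–Iftimie–Planchon decay (none in the tree); here "size → ∞" is PARABOLIC CONCENTRATION — the
essential suprema of `|u_k|` on the backward cylinders `Q_r(1, x_k)` tend to `∞` for every radius `r` —
and the extraction is Rusin–Šverák's proof of Cor. 4.2/4.3 run with the QUANTITATIVE ε-regularity
criterion (RRS 2016 Thm. 15.3, `RRS2016.theorem15_3_holds`) in place of the qualitative one.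

Composition (`MinimalDatumPFold_of`, sorry-free outside the stubs):
Clay failure ⇒ `ρ_max^pure(ν) < ⊤` (`stub_thresholdFinite_of_clayFailure`, LANDED p147201) ⇒
`stub_axisymConcentrationBranch` (THE OPEN RESIDUAL: a sequence of exactly axisymmetric sub-threshold data
whose Kato solutions on `[0,1)` concentrate at `(1, x_k)`) ⇒ `stub_concentrationNearMinimalLimit`
(fed with `stub_concentrationWeakLimitBlowup`, itself fed with `stub_uniformRegularity`): translated
subsequence converges in `L³` to a MINIMAL blow-up datum ⇒ `stub_symmetryDefectInLimit` (LANDED p151913: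
the `R_{2π/p}`-symmetry survives up to a horizontal shift) ⇒ `stub_liftRecentre` (LANDED p147155) ⇒
`stub_liftAeToExact` (LANDED p149205) ⇒ the crux with `p := max N 2`.

Stubs (5 registered): Stubs 1–3 LANDED (p157006, p157748, p158054) and Stub 5 = the DOMINANCE converse LANDED (p159771),
all discharged below BY NAME; Stub 4 = the ONE OPEN residual (the only `sorry` of this file):
* `stub_uniformRegularity` — quantitative form of Rusin–Šverák Lemma 2.1: in the situation of Prop. 2.2,
  near a REGULAR point of the limit the approximants are UNIFORMLY essentially bounded, eventually in `k`
  (the tree's proof of `rusin_sverak_stability_of_singularities_of_unforced` with the bound of Thm. 15.3 kept).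
* `stub_concentrationWeakLimitBlowup` — concentration analogue of `rusin_sverak_weak_limit_blowup`: weak
  `Ḣ^{1/2}`-limits of (translated) data whose Kato solutions concentrate at `(1, x_k)` have no global Kato
  solution (E, W, R, K of `RusinSverakLeraySolutions/Stability` + the previous stub; viscosity by scaling).
* `stub_concentrationNearMinimalLimit` — analogue of the landed `stub_nearMinimalLimit`: for sub-threshold
  concentrating sequences the modulated data converge STRONGLY in `L³` along a subsequence to a minimal
  blow-up datum (weak compactness, the previous stub, norm squeeze `‖glim‖ = ρ_max`, Radon–Riesz, BCD 1.38).
* `stub_axisymConcentrationBranch` — OPEN (the sub-threshold branch of the card): for `ν > 0` with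
  `ρ_max^pure(ν) < ⊤` there are axisymmetric admissible data of norm `< ρ_max^pure(ν)` (hence global) with
  Kato solutions on `[0,1)` concentrating at `(1, x_k)`. Implied by the crux (`c·φ`, `c ↑ 1`, strong
  stability of singular points) and implying it (this file): no strength lost or gained.

Disproof used (Cruxes/MinimalDatumPFold/Disproof.lean, cdisprove cycle 1): §1 (irrefutable short of ¬Clay —
the residual keeps the `ρ_max^pure < ⊤` antecedent derived from Clay failure), §2 (H1 honoured: without the
antecedent the residual is false at a Kato-regular viscosity, as it must be), §3 (`not_abstractExtremality`:
nothing here infers symmetry from compactness + invariance; symmetry is an INPUT of the residual and is only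
TRANSPORTED through limits), §4 (the coupling "near-minimal ∧ symmetric" is delivered as "sub-threshold ∧
symmetric ∧ concentrating"). Rotation `R_θ` WRITTEN OUT as in the route file (no `AxisymmetricEuler` import).
-/

set_option linter.dupNamespace false

noncomputable section

namespace Summit.NavierStokesRegularity.NavierStokesRegularity.Cruxes.MinimalDatumPFold.SubthresholdBranch

open Summit.NavierStokesRegularity.NavierStokesRegularity.Theorems

/-- **Stub 1 (provable now, size L) — uniform regularity near regular points of the limit**
(quantitative Rusin–Šverák Lemma 2.1 = Jia–Šverák Lemma 6). In the situation of Rusin–Šverák's Prop. 2.2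
on an open set `O` (suitable weak solutions `(u^k, p^k)`, unit viscosity, locally uniformly bounded in the
energy space and in `L^{3/2}`, `u^k → u` in `L³_loc`, `p^k ⇀ p`), if `z₀ ∈ O` is a REGULAR point of the
limit `u` (essentially bounded on some centred cylinder `Q*_r(z₀)`), then there are `ρ > 0` and a bound
`B` such that, for all sufficiently large `k`, `|u^k| ≤ B` a.e. on `Q*_ρ(z₀)`. Proof: the tree's proof of
`rusin_sverak_stability_of_singularities_of_unforced` (`RusinSverakSingularityStability.lean`) verbatim,
with the one-scale criterion in the QUANTITATIVE form supplied by `RRS2016.theorem15_3_holds`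
(`‖u‖ ≤ c_M ε₀^{1/3}/s` a.e. on `Q_{s/2}(z')`, cf. the proof of `RRS2016.theorem15_3.unforced_oneScale`)
and the event `∀ᶠ k` kept instead of one witness `k`. [cite: RusinSverak2011, Lemma 2.1 and its proof
(arXiv:0911.0500 p. 4); RobinsonRodrigoSadowski2016 Thm. 15.3] -/
theorem stub_uniformRegularity :
    ∀ (O : TopologicalSpace.Opens (ℝ × EuclideanSpace ℝ (Fin 3))) (useq : ℕ → ℝ → EuclideanSpace ℝ (Fin 3) → EuclideanSpace ℝ (Fin 3)) (pseq : ℕ → ℝ → EuclideanSpace ℝ (Fin 3) → ℝ) (u : ℝ → EuclideanSpace ℝ (Fin 3) → EuclideanSpace ℝ (Fin 3)) (p : ℝ → EuclideanSpace ℝ (Fin 3) → ℝ), Literature.Analysis.FluidPDE.RusinSverak2011.CompactnessSituation O useq pseq u p → ∀ z₀ : ℝ × EuclideanSpace ℝ (Fin 3), z₀ ∈ O → Literature.Analysis.FluidPDE.IsRegularPoint u z₀ → ∃ ρ : ℝ, 0 < ρ ∧ ∃ B : NNReal, ∀ᶠ k : ℕ in Filter.atTop, MeasureTheory.eLpNorm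 (Function.uncurry (useq k)) ⊤ (MeasureTheory.volume.restrict (Literature.Analysis.FluidPDE.parabolicCylinderCentered ρ z₀)) ≤ (B : ENNReal) :=
  Summit.NavierStokesRegularity.NavierStokesRegularity.Theorems.stub_uniformRegularity

/-- **Stub 2 (provable now, size M–L) — weak limits of concentrating sequences blow up**
(concentration analogue of `Literature.Analysis.FluidPDE.rusin_sverak_weak_limit_blowup`, Rusin–Šverák
Cor. 4.2 and sentence 2 of the proof of Cor. 4.3). GIVEN Stub 1: for `ν > 0`, weakly divergence-free `L³`
data `U k` represented by classes `G k` bounded in `Ḣ^{1/2}`, with Kato-class mild solutions `u k` on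
`[0, 1)` (viscosity `ν`) which CONCENTRATE at `(1, x k)` — for every `r > 0` the essential supremum of
`|u k|` on the backward cylinder `Q_r(1, x k)` tends to `∞` — there is a modulation (`lam k > 0`, `x₀ k`)
such that every weak `Ḣ^{1/2}`-limit of a subsequence of the classes of the modulated data
`y ↦ lam k • U k (lam k • y - x₀ k)` is represented by an `L³`, weakly divergence-free datum WITHOUT a global
Kato solution. Proof: reduce to `ν = 1` (`u ↦ ν⁻¹ u(ν⁻¹ t, ·)`, `hasGlobalKatoSolution_smul_iff`,
`IsMildNSSolutionOn.timeRescale`), normalise `(T, x_k) = (ν, x k) ↦ (1, 0)` (`kato_local_rescale_translate`,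
`eLpNorm_top_uncurry_rescale_translate`); Leray solutions of the data exist (E
`leray_solution_exists_of_memLp_three_holds`) and agree with the Kato solutions below `t = 1` (W
`leray_solution_ae_eq_kato_holds`), so they concentrate too; K (`rusin_sverak_leray_weak_stability_holds`)
puts a subsequence and a Leray solution of the limit datum in the situation of Prop. 2.2; a global Kato
solution of the limit would make `(1, 0)` a regular point of that Leray solution (W, R
`kato_solution_le_div_sqrt_holds`, B `isRegularPoint_of_eLpNorm_parabolicCylinder_lt_top_holds`), and Stub 1
would bound the approximants uniformly on `Q_{ρ/2}(1, 0)` — contradicting concentration.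
[cite: RusinSverak2011, Cor. 4.2 and proof of Cor. 4.3 (arXiv:0911.0500 p. 8)] -/
theorem stub_concentrationWeakLimitBlowup :
    (∀ (O : TopologicalSpace.Opens (ℝ × EuclideanSpace ℝ (Fin 3))) (useq : ℕ → ℝ → EuclideanSpace ℝ (Fin 3) → EuclideanSpace ℝ (Fin 3)) (pseq : ℕ → ℝ → EuclideanSpace ℝ (Fin 3) → ℝ) (u : ℝ → EuclideanSpace ℝ (Fin 3) → EuclideanSpace ℝ (Fin 3)) (p : ℝ → EuclideanSpace ℝ (Fin 3) → ℝ), Literature.Analysis.FluidPDE.RusinSverak2011.CompactnessSituation O useq pseq u p → ∀ z₀ : ℝ × EuclideanSpace ℝ (Fin 3), z₀ ∈ O → Literature.Analysis.FluidPDE.IsRegularPoint u z₀ → ∃ ρ : ℝ, 0 < ρ ∧ ∃ B : NNReal, ∀ᶠ k : ℕ in Filter.atTop, MeasureTheory.eLpNorm (Function.uncurry (useq k)) ⊤ (MeasureTheory.volume.restrict (Literature.Analysis.FluidPDE.parabolicCylinderCentered ρ z₀)) ≤ (B : ENNReal)) →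
    ∀ ν : ℝ, 0 < ν → ∀ (U : ℕ → EuclideanSpace ℝ (Fin 3) → EuclideanSpace ℝ (Fin 3)) (G : ℕ → Literature.Analysis.FunctionSpaces.HomSobolev (EuclideanSpace ℝ (Fin 3)) (EuclideanSpace ℂ (Fin 3)) (1 / 2 : ℝ)) (u : ℕ → ℝ → EuclideanSpace ℝ (Fin 3) → EuclideanSpace ℝ (Fin 3)) (x : ℕ → EuclideanSpace ℝ (Fin 3)), (∀ k, MeasureTheory.MemLp (U k) 3 (MeasureTheory.volume : MeasureTheory.Measure (EuclideanSpace ℝ (Fin 3))) ∧ (G k).Represents (Literature.Analysis.FunctionSpaces.EuclideanSpace.complexify ∘ U k) ∧ Literature.Analysis.FluidPDE.IsWeaklyDivFree (U k)) → (∃ R : ℝ, ∀ k, ‖G k‖ ≤ R) → (∀ k, Literature.Analysis.FluidPDE.IsMildNSSolutionOn (Set.Ico 0 1) ν 0 (U k) (u k) ∧ Literature.Analysis.FluidPDE.ContinuousInLpOn (Set.Ico 0 1) 3 (u k) ∧ u k 0 = U k ∧ MeasureTheory.AEStronglyMeasurable (Function.uncurry (u k)) (MeasureTheory.volume.restrict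 (Set.Ioo (0 : ℝ) 1 ×ˢ (Set.univ : Set (EuclideanSpace ℝ (Fin 3)))))) → (∀ r : ℝ, 0 < r → Filter.Tendsto (fun k => MeasureTheory.eLpNorm (Function.uncurry (u k)) ⊤ (MeasureTheory.volume.restrict (Literature.Analysis.FluidPDE.parabolicCylinder r ((1 : ℝ), x k)))) Filter.atTop (nhds ⊤)) → ∃ (lam : ℕ → ℝ) (x₀ : ℕ → EuclideanSpace ℝ (Fin 3)), (∀ k, 0 < lam k) ∧ ∀ g' : ℕ → Literature.Analysis.FunctionSpaces.HomSobolev (EuclideanSpace ℝ (Fin 3)) (EuclideanSpace ℂ (Fin 3)) (1 / 2 : ℝ), (∀ k, (g' k).Represents (Literature.Analysis.FunctionSpaces.EuclideanSpace.complexify ∘ Literature.Analysis.FluidPDE.rescaleData (lam k) (fun y => U k (y - x₀ k)))) → ∀ φ : ℕ → ℕ, StrictMono φ → ∀ glim : Literature.Analysis.FunctionSpaces.HomSobolev (EuclideanSpace ℝ (Fin 3)) (EuclideanSpace ℂ (Fin 3)) (1 / 2 : ℝ), (∀ w, Filter.Tendsto (fun n => inner ℂ (g' (φ n)) w) Filter.atTop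 (nhds (inner ℂ glim w))) → ∃ v₀ : EuclideanSpace ℝ (Fin 3) → EuclideanSpace ℝ (Fin 3), MeasureTheory.MemLp v₀ 3 (MeasureTheory.volume : MeasureTheory.Measure (EuclideanSpace ℝ (Fin 3))) ∧ glim.Represents (Literature.Analysis.FunctionSpaces.EuclideanSpace.complexify ∘ v₀) ∧ Literature.Analysis.FluidPDE.IsWeaklyDivFree v₀ ∧ ¬ Literature.Analysis.FluidPDE.HasGlobalKatoSolution ν v₀ :=
  Summit.NavierStokesRegularity.NavierStokesRegularity.Theorems.stub_concentrationWeakLimitBlowup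

/-- **Stub 3 (provable now, size M–L) — sub-threshold concentrating sequences have minimal `L³`-limits
modulo `Sim`** (the analogue of the landed `stub_nearMinimalLimit`, p151693, with the weak-limit blow-up leaf
replaced by Stub 2). GIVEN the statement of Stub 2: for `ν > 0` with `ρ := ρ_max^pure(ν) < ⊤`, admissible
data `(U k, G k)` with `‖G k‖ₑ < ρ` (hence GLOBAL) whose Kato solutions `u k` on `[0,1)` concentrate at
`(1, x k)` admit a modulation `lam j > 0`, `x₀ j`, a subsequence `φ` and a MINIMAL blow-up datum
`(v, g) ∈ M` with `lam j • U (φ j) (lam j • y - x₀ j) → v` in `L³(ℝ³)`. Proof = the tree's proof of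
`stub_nearMinimalLimit`: the modulated classes have the norms of the `G k` (`exists_represents_rescaleData_norm_eq`),
hence a weakly convergent subsequence (`exists_strictMono_tendsto_inner`); by Stub 2 the weak limit `glim`
represents a blow-up datum `v`, so `ρ ≤ ‖glim‖ₑ` (`hasGlobalKatoSolution_of_lt_rusinSverakRhoMaxPure`),
while `‖glim‖ ≤ liminf ‖G (φ n)‖ ≤ ρ` (weak l.s.c.): `(v, glim) ∈ M` and `‖G (φ n)‖ → ‖glim‖`, so
Radon–Riesz gives strong `Ḣ^{1/2}` convergence and `eLpNorm_three_sub_le_of_represents` the `L³` one.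
[cite: RusinSverak2011, Cor. 4.3 and its proof (arXiv:0911.0500 p. 8)] -/
theorem stub_concentrationNearMinimalLimit :
    (∀ ν : ℝ, 0 < ν → ∀ (U : ℕ → EuclideanSpace ℝ (Fin 3) → EuclideanSpace ℝ (Fin 3)) (G : ℕ → Literature.Analysis.FunctionSpaces.HomSobolev (EuclideanSpace ℝ (Fin 3)) (EuclideanSpace ℂ (Fin 3)) (1 / 2 : ℝ)) (u : ℕ → ℝ → EuclideanSpace ℝ (Fin 3) → EuclideanSpace ℝ (Fin 3)) (x : ℕ → EuclideanSpace ℝ (Fin 3)), (∀ k, MeasureTheory.MemLp (U k) 3 (MeasureTheory.volume : MeasureTheory.Measure (EuclideanSpace ℝ (Fin 3))) ∧ (G k).Represents (Literature.Analysis.FunctionSpaces.EuclideanSpace.complexify ∘ U k) ∧ Literature.Analysis.FluidPDE.IsWeaklyDivFree (U k)) → (∃ R : ℝ, ∀ k, ‖G k‖ ≤ R) → (∀ k, Literature.Analysis.FluidPDE.IsMildNSSolutionOn (Set.Ico 0 1) ν 0 (U k) (u k) ∧ Literature.Analysis.FluidPDE.ContinuousInLpOn (Set.Ico 0 1) 3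 (u k) ∧ u k 0 = U k ∧ MeasureTheory.AEStronglyMeasurable (Function.uncurry (u k)) (MeasureTheory.volume.restrict (Set.Ioo (0 : ℝ) 1 ×ˢ (Set.univ : Set (EuclideanSpace ℝ (Fin 3)))))) → (∀ r : ℝ, 0 < r → Filter.Tendsto (fun k => MeasureTheory.eLpNorm (Function.uncurry (u k)) ⊤ (MeasureTheory.volume.restrict (Literature.Analysis.FluidPDE.parabolicCylinder r ((1 : ℝ), x k)))) Filter.atTop (nhds ⊤)) → ∃ (lam : ℕ → ℝ) (x₀ : ℕ → EuclideanSpace ℝ (Fin 3)), (∀ k, 0 < lam k) ∧ ∀ g' : ℕ → Literature.Analysis.FunctionSpaces.HomSobolev (EuclideanSpace ℝ (Fin 3)) (EuclideanSpace ℂ (Fin 3)) (1 / 2 : ℝ), (∀ k, (g' k).Represents (Literature.Analysis.FunctionSpaces.EuclideanSpace.complexify ∘ Literature.Analysis.FluidPDE.rescaleData (lam k) (fun y => U k (y - x₀ k)))) → ∀ φ : ℕ → ℕ, StrictMono φ → ∀ glim : Literature.Analysis.FunctionSpaces.HomSobolev (EuclideanSpace ℝ (Fin 3)) (EuclideanSpace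 ℂ (Fin 3)) (1 / 2 : ℝ), (∀ w, Filter.Tendsto (fun n => inner ℂ (g' (φ n)) w) Filter.atTop (nhds (inner ℂ glim w))) → ∃ v₀ : EuclideanSpace ℝ (Fin 3) → EuclideanSpace ℝ (Fin 3), MeasureTheory.MemLp v₀ 3 (MeasureTheory.volume : MeasureTheory.Measure (EuclideanSpace ℝ (Fin 3))) ∧ glim.Represents (Literature.Analysis.FunctionSpaces.EuclideanSpace.complexify ∘ v₀) ∧ Literature.Analysis.FluidPDE.IsWeaklyDivFree v₀ ∧ ¬ Literature.Analysis.FluidPDE.HasGlobalKatoSolution ν v₀) →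
    ∀ ν : ℝ, 0 < ν → Literature.Analysis.FluidPDE.rusinSverakRhoMaxPure ν < ⊤ → ∀ (U : ℕ → EuclideanSpace ℝ (Fin 3) → EuclideanSpace ℝ (Fin 3)) (G : ℕ → Literature.Analysis.FunctionSpaces.HomSobolev (EuclideanSpace ℝ (Fin 3)) (EuclideanSpace ℂ (Fin 3)) (1 / 2 : ℝ)) (u : ℕ → ℝ → EuclideanSpace ℝ (Fin 3) → EuclideanSpace ℝ (Fin 3)) (x : ℕ → EuclideanSpace ℝ (Fin 3)), (∀ k, MeasureTheory.MemLp (U k) 3 (MeasureTheory.volume : MeasureTheory.Measure (EuclideanSpace ℝ (Fin 3))) ∧ (G k).Represents (Literature.Analysis.FunctionSpaces.EuclideanSpace.complexify ∘ U k) ∧ Literature.Analysis.FluidPDE.IsWeaklyDivFree (U k) ∧ ‖G k‖ₑ < Literature.Analysis.FluidPDE.rusinSverakRhoMaxPure ν) → (∀ k, Literature.Analysis.FluidPDE.IsMildNSSolutionOn (Set.Ico 0 1) ν 0 (U k) (u k) ∧ Literature.Analysis.FluidPDE.ContinuousInLpOn (Set.Ico 0 1) 3 (u k) ∧ u k 0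 = U k ∧ MeasureTheory.AEStronglyMeasurable (Function.uncurry (u k)) (MeasureTheory.volume.restrict (Set.Ioo (0 : ℝ) 1 ×ˢ (Set.univ : Set (EuclideanSpace ℝ (Fin 3)))))) → (∀ r : ℝ, 0 < r → Filter.Tendsto (fun k => MeasureTheory.eLpNorm (Function.uncurry (u k)) ⊤ (MeasureTheory.volume.restrict (Literature.Analysis.FluidPDE.parabolicCylinder r ((1 : ℝ), x k)))) Filter.atTop (nhds ⊤)) → ∃ (lam : ℕ → ℝ) (x₀ : ℕ → EuclideanSpace ℝ (Fin 3)) (φ : ℕ → ℕ) (v : EuclideanSpace ℝ (Fin 3) → EuclideanSpace ℝ (Fin 3)) (g : Literature.Analysis.FunctionSpaces.HomSobolev (EuclideanSpace ℝ (Fin 3)) (EuclideanSpace ℂ (Fin 3)) (1 / 2 : ℝ)), (∀ j, 0 < lam j) ∧ StrictMono φ ∧ Literature.Analysis.FluidPDE.IsMinimalBlowupDatum ν v g ∧ Filter.Tendsto (fun j => MeasureTheory.eLpNorm (Literature.Analysis.FluidPDE.rescaleData (lam j) (fun y => U (φ j) (y - x₀ j)) - v) 3 (MeasureTheory.volume :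 MeasureTheory.Measure (EuclideanSpace ℝ (Fin 3)))) Filter.atTop (nhds 0) :=
  Summit.NavierStokesRegularity.NavierStokesRegularity.Theorems.stub_concentrationNearMinimalLimit

/-- **Stub 4 — THE OPEN RESIDUAL (the sub-threshold branch; size XL / open).** For `ν > 0` at which Clay (A)
fails (VERBATIM the crux's antecedent; it gives `ρ_max^pure(ν) < ⊤` by `stub_thresholdFinite_of_clayFailure`,
and keeping it makes the residual exactly as strong as the crux, Disproof §2 (H1)): there is a
sequence of admissible data `U k` (`L³`, represented by `G k ∈ Ḣ^{1/2}`, weakly divergence-free) which are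
EXACTLY axisymmetric about the `x₂`-axis (equivariant under every `R_θ`, written out as in the route file),
SUB-THRESHOLD (`‖G k‖ₑ < ρ_max^pure(ν)`, hence global by the definition of the threshold), with Kato-class mild
solutions `u k` on `[0, 1)` that CONCENTRATE at the points `(1, x k)`: for every radius `r > 0` the essential
supremum of `|u k|` on the backward parabolic cylinder `Q_r(1, x k) = (1 - r², 1) × B_r(x k)` tends to `∞`.
This is the card's "the axisymmetric branch of sub-threshold data reaches the threshold with size → ∞",
with size measured by parabolic concentration (time normalised to `1` by the scaling, which preserves the
axisymmetric class; the concentration point is free — it need not lie on the axis). It is EQUIVALENT to the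
crux: this file proves residual ⇒ crux; conversely an axisymmetric minimal blow-up datum `φ` (crux + the proved
sibling `PFoldToAxisymmetric`), normalised to blow up first at `t = 1` with singular point `x_*`, gives the
witnesses `U k = (1 - (k+2)⁻¹) • φ`, whose (global) solutions concentrate at `(1, x_*)` by the strong form of
Rusin–Šverák's stability of singular points. Why it might be provable where the threshold forms are not: it
quantifies over GLOBAL smooth axisymmetric solutions only (no blow-up object, no minimality, no `M̂`), its
finite pieces `ess sup_{Q_r} |u k| > M` are open conditions certifiable for single data, and the axisymmetric
class carries structure (swirl `Γ = r u_θ`, the Hou–Luo / Hou 2022 axisymmetric amplification scenarios are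
exactly candidate branches). Why it might fail: it is equivalent to `ρ_ax = ρ_max`; symmetric concentration
may be strictly dearer at every viscosity where Clay fails; irrefutable short of `¬Clay` (Disproof §1).
[sources: RusinSverak2011 Cor. 4.2–4.3; arXiv:1012.0145 §4; Hou2022PotentiallySingularNS; idea card
subthreshold-dissipation-branch (Lu–Doering 2008, Ayala–Protas 2017, Kang–Protas 2022 numerics)] -/
theorem stub_axisymConcentrationBranch :
    ∀ ν : ℝ, 0 < ν → (∃ v₀ : EuclideanSpace ℝ (Fin 3) → EuclideanSpace ℝ (Fin 3), ContDiff ℝ (⊤ : ℕ∞) v₀ ∧ Literature.Analysis.FluidPDE.NSWave0.IsDivFree v₀ ∧ Literature.Analysis.FluidPDE.HasRapidSpatialDecay v₀ ∧ ¬ ∃ (u : ℝ → EuclideanSpace ℝ (Fin 3) → EuclideanSpace ℝ (Fin 3)) (p : ℝ → EuclideanSpace ℝ (Fin 3) → ℝ), Literature.Analysis.FluidPDE.IsSmoothOnHalfSpace u ∧ Literature.Analysis.FluidPDE.IsSmoothOnHalfSpace p ∧ Literature.Analysis.FluidPDE.IsNavierStokesSolution ν 0 v₀ u p ∧ Literature.Analysis.FluidPDE.HasBoundedEnergy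 u) → ∃ (U : ℕ → EuclideanSpace ℝ (Fin 3) → EuclideanSpace ℝ (Fin 3)) (G : ℕ → Literature.Analysis.FunctionSpaces.HomSobolev (EuclideanSpace ℝ (Fin 3)) (EuclideanSpace ℂ (Fin 3)) (1 / 2 : ℝ)) (u : ℕ → ℝ → EuclideanSpace ℝ (Fin 3) → EuclideanSpace ℝ (Fin 3)) (x : ℕ → EuclideanSpace ℝ (Fin 3)), (∀ k, MeasureTheory.MemLp (U k) 3 (MeasureTheory.volume : MeasureTheory.Measure (EuclideanSpace ℝ (Fin 3))) ∧ (G k).Represents (Literature.Analysis.FunctionSpaces.EuclideanSpace.complexify ∘ U k) ∧ Literature.Analysis.FluidPDE.IsWeaklyDivFree (U k) ∧ ‖G k‖ₑ < Literature.Analysis.FluidPDE.rusinSverakRhoMaxPure ν) ∧ (∀ k, Literature.Analysis.FluidPDE.IsMildNSSolutionOn (Set.Ico 0 1) ν 0 (U k) (u k) ∧ Literature.Analysis.FluidPDE.ContinuousInLpOn (Set.Ico 0 1) 3 (u k) ∧ u k 0 = U k ∧ MeasureTheory.AEStronglyMeasurable (Function.uncurry (u k)) (MeasureTheory.volume.restrict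 (Set.Ioo (0 : ℝ) 1 ×ˢ (Set.univ : Set (EuclideanSpace ℝ (Fin 3)))))) ∧ (∀ r : ℝ, 0 < r → Filter.Tendsto (fun k => MeasureTheory.eLpNorm (Function.uncurry (u k)) ⊤ (MeasureTheory.volume.restrict (Literature.Analysis.FluidPDE.parabolicCylinder r ((1 : ℝ), x k)))) Filter.atTop (nhds ⊤)) ∧ (∀ k (θ : ℝ) (y : EuclideanSpace ℝ (Fin 3)), U k (WithLp.toLp 2 ![Real.cos θ * y 0 - Real.sin θ * y 1, Real.sin θ * y 0 + Real.cos θ * y 1, y 2]) = WithLp.toLp 2 ![Real.cos θ * U k y 0 - Real.sin θ * U k y 1, Real.sin θ * U k y 0 + Real.cos θ * U k y 1, U k y 2]) := by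
  sorry

/-- **Stub 5 (provable now, size L; DOMINANCE, not used by the composition) — the residual is implied by
an axisymmetric minimal blow-up datum.** For `ν > 0`: if some Rusin–Šverák minimal blow-up datum `(u₀, g)` at
viscosity `ν` is exactly axisymmetric about the `x₂`-axis (this is what the crux yields through the PROVED
sibling crux `PFoldToAxisymmetric`, `axisymmetricExtremality_pFoldToAxisymmetric_proof`), then the conclusion
of `stub_axisymConcentrationBranch` holds at `ν`. Together with `MinimalDatumPFold_of` this certifies
residual ⇔ crux (no strength lost or gained by the re-typing). Proof: pass to unit viscosity
(`IsMinimalBlowupDatum.inv_smul`), take the Kato solution `w` of the datum up to its first singular time `T`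
with a singular point `(T, x_*)` (`rusin_sverak_singular_point_of_blowup_holds`), normalise `T = 1` by the
scaling `λ = √T` WITHOUT translating (`kato_local_rescale_translate` with `x₀ = 0`; the axisymmetric class,
the norm `ρ_max^pure` and non-globality are scale invariant: `exists_represents_rescaleData_norm_eq`,
`hasGlobalKatoSolution_rescaleData_iff`), and put `U k := (1 - (k+2)⁻¹) • ψ`: axisymmetric, of norm
`< ρ_max^pure` (`ρ_max^pure > 0` since `ψ` is not a.e. zero), hence global; their Kato solutions restricted to
`[0,1)` concentrate at `(1, x_*)` — otherwise along a subsequence they are uniformly bounded on some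
`Q_r(1, x_*)`, the Leray solutions (E `leray_solution_exists_of_memLp_three_holds`, = Kato a.e., W
`leray_solution_ae_eq_kato_holds`) inherit the bound, K (`rusin_sverak_leray_weak_stability_holds`, the data
converge strongly hence weakly to `ψ`) extracts an `L³_loc`-limit Leray solution of `ψ`, bounded by the same
constant on `Q_r(1, x_*)`, yet equal a.e. below `t = 1` to the singular Kato solution `w` (W) — contradiction.
Scale back to viscosity `ν` (`u ↦ ν u(ν t, ·)`, `hasGlobalKatoSolution_smul_iff`, `IsMildNSSolutionOn.timeRescale`,
`rusinSverakRhoMaxPure_eq_mul_holds`). [cite: RusinSverak2011, §4 p. 6 (finite `T_max` forces a singular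
point), Thm. 4.2, Cor. 4.2 (arXiv:0911.0500 pp. 6–8)] -/
theorem stub_branchOfAxisymMinimalDatum :
    ∀ ν : ℝ, 0 < ν → (∃ (u₀ : EuclideanSpace ℝ (Fin 3) → EuclideanSpace ℝ (Fin 3)) (g : Literature.Analysis.FunctionSpaces.HomSobolev (EuclideanSpace ℝ (Fin 3)) (EuclideanSpace ℂ (Fin 3)) (1 / 2 : ℝ)), Literature.Analysis.FluidPDE.IsMinimalBlowupDatum ν u₀ g ∧ ∀ (θ : ℝ) (y : EuclideanSpace ℝ (Fin 3)), u₀ (WithLp.toLp 2 ![Real.cos θ * y 0 - Real.sin θ * y 1, Real.sin θ * y 0 + Real.cos θ * y 1, y 2]) = WithLp.toLp 2 ![Real.cos θ * u₀ y 0 - Real.sin θ * u₀ y 1, Real.sin θ * u₀ y 0 + Real.cos θ * u₀ y 1, u₀ y 2]) → ∃ (U : ℕ → EuclideanSpace ℝ (Fin 3) → EuclideanSpace ℝ (Fin 3)) (G : ℕ → Literature.Analysis.FunctionSpaces.HomSobolev (EuclideanSpace ℝ (Fin 3)) (EuclideanSpace ℂ (Fin 3)) (1 / 2 : ℝ)) (u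 : ℕ → ℝ → EuclideanSpace ℝ (Fin 3) → EuclideanSpace ℝ (Fin 3)) (x : ℕ → EuclideanSpace ℝ (Fin 3)), (∀ k, MeasureTheory.MemLp (U k) 3 (MeasureTheory.volume : MeasureTheory.Measure (EuclideanSpace ℝ (Fin 3))) ∧ (G k).Represents (Literature.Analysis.FunctionSpaces.EuclideanSpace.complexify ∘ U k) ∧ Literature.Analysis.FluidPDE.IsWeaklyDivFree (U k) ∧ ‖G k‖ₑ < Literature.Analysis.FluidPDE.rusinSverakRhoMaxPure ν) ∧ (∀ k, Literature.Analysis.FluidPDE.IsMildNSSolutionOn (Set.Ico 0 1) ν 0 (U k) (u k) ∧ Literature.Analysis.FluidPDE.ContinuousInLpOn (Set.Ico 0 1) 3 (u k) ∧ u k 0 = U k ∧ MeasureTheory.AEStronglyMeasurable (Function.uncurry (u k)) (MeasureTheory.volume.restrict (Set.Ioo (0 : ℝ) 1 ×ˢ (Set.univ : Set (EuclideanSpace ℝ (Fin 3)))))) ∧ (∀ r : ℝ, 0 < r → Filter.Tendsto (fun k => MeasureTheory.eLpNorm (Function.uncurry (u k)) ⊤ (MeasureTheory.volume.restrict (Literature.Analysis.FluidPDE.parabolicCylinder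 r ((1 : ℝ), x k)))) Filter.atTop (nhds ⊤)) ∧ (∀ k (θ : ℝ) (y : EuclideanSpace ℝ (Fin 3)), U k (WithLp.toLp 2 ![Real.cos θ * y 0 - Real.sin θ * y 1, Real.sin θ * y 0 + Real.cos θ * y 1, y 2]) = WithLp.toLp 2 ![Real.cos θ * U k y 0 - Real.sin θ * U k y 1, Real.sin θ * U k y 0 + Real.cos θ * U k y 1, U k y 2]) :=
  Summit.NavierStokesRegularity.NavierStokesRegularity.Theorems.stub_branchOfAxisymMinimalDatum

/-- **Exactness of the re-typing (sorry-free modulo Stub 5): the crux implies the residual.** By the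
PROVED sibling crux `PFoldToAxisymmetric` an instance of the crux's conclusion at `ν` yields an axisymmetric
minimal blow-up datum, and Stub 5 turns it into the concentrating sub-threshold branch. Hence, with
`MinimalDatumPFold_of`, `stub_axisymConcentrationBranch ⇔ MinimalDatumPFold` over the tree. [folklore] -/
theorem branch_of_minimalDatumPFold
    (h : Summit.NavierStokesRegularity.NavierStokesRegularity.Theses.AxisymmetricExtremality.MinimalDatumPFold) :
    ∀ ν : ℝ, 0 < ν → (∃ v₀ : EuclideanSpace ℝ (Fin 3) → EuclideanSpace ℝ (Fin 3), ContDiff ℝ (⊤ : ℕ∞) v₀ ∧ Literature.Analysis.FluidPDE.NSWave0.IsDivFree v₀ ∧ Literature.Analysis.FluidPDE.HasRapidSpatialDecay v₀ ∧ ¬ ∃ (u : ℝ → EuclideanSpace ℝ (Fin 3) → EuclideanSpace ℝ (Fin 3)) (p : ℝ → EuclideanSpace ℝ (Fin 3) → ℝ), Literature.Analysis.FluidPDE.IsSmoothOnHalfSpace u ∧ Literature.Analysis.FluidPDE.IsSmoothOnHalfSpace p ∧ Literature.Analysis.FluidPDE.IsNavierStokesSolution ν 0 v₀ u p ∧ Literature.Analysis.FluidPDE.HasBoundedEnergy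 u) → ∃ (U : ℕ → EuclideanSpace ℝ (Fin 3) → EuclideanSpace ℝ (Fin 3)) (G : ℕ → Literature.Analysis.FunctionSpaces.HomSobolev (EuclideanSpace ℝ (Fin 3)) (EuclideanSpace ℂ (Fin 3)) (1 / 2 : ℝ)) (u : ℕ → ℝ → EuclideanSpace ℝ (Fin 3) → EuclideanSpace ℝ (Fin 3)) (x : ℕ → EuclideanSpace ℝ (Fin 3)), (∀ k, MeasureTheory.MemLp (U k) 3 (MeasureTheory.volume : MeasureTheory.Measure (EuclideanSpace ℝ (Fin 3))) ∧ (G k).Represents (Literature.Analysis.FunctionSpaces.EuclideanSpace.complexify ∘ U k) ∧ Literature.Analysis.FluidPDE.IsWeaklyDivFree (U k) ∧ ‖G k‖ₑ < Literature.Analysis.FluidPDE.rusinSverakRhoMaxPure ν) ∧ (∀ k, Literature.Analysis.FluidPDE.IsMildNSSolutionOn (Set.Ico 0 1) ν 0 (U k) (u k) ∧ Literature.Analysis.FluidPDE.ContinuousInLpOn (Set.Ico 0 1) 3 (u k) ∧ u k 0 = U k ∧ MeasureTheory.AEStronglyMeasurable (Function.uncurry (u k)) (MeasureTheory.volume.restrict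 (Set.Ioo (0 : ℝ) 1 ×ˢ (Set.univ : Set (EuclideanSpace ℝ (Fin 3)))))) ∧ (∀ r : ℝ, 0 < r → Filter.Tendsto (fun k => MeasureTheory.eLpNorm (Function.uncurry (u k)) ⊤ (MeasureTheory.volume.restrict (Literature.Analysis.FluidPDE.parabolicCylinder r ((1 : ℝ), x k)))) Filter.atTop (nhds ⊤)) ∧ (∀ k (θ : ℝ) (y : EuclideanSpace ℝ (Fin 3)), U k (WithLp.toLp 2 ![Real.cos θ * y 0 - Real.sin θ * y 1, Real.sin θ * y 0 + Real.cos θ * y 1, y 2]) = WithLp.toLp 2 ![Real.cos θ * U k y 0 - Real.sin θ * U k y 1, Real.sin θ * U k y 0 + Real.cos θ * U k y 1, U k y 2]) :=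
  fun ν hν hclay => stub_branchOfAxisymMinimalDatum ν hν
    (axisymmetricExtremality_pFoldToAxisymmetric_proof ν hν (h ν hν hclay))

/-- **Composition (sorry-free outside the four stubs): the line closes the crux.** Clay failure at `ν` ⇒
`ρ_max^pure(ν) < ⊤` (landed front end) ⇒ the axisymmetric sub-threshold concentrating sequence (Stub 4) ⇒ a
modulated subsequence converges in `L³` to a minimal blow-up datum (Stub 3 ∘ Stub 2 ∘ Stub 1) ⇒ the datum is
`R_{2π/p}`-equivariant up to a horizontal shift (`stub_symmetryDefectInLimit`, landed), recentred
(`stub_liftRecentre`, landed) and made exactly equivariant (`stub_liftAeToExact`, landed), for `p := max N 2`.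
[cite: RusinSverak2011, Cor. 4.3 and its proof (arXiv:0911.0500 p. 8)] -/
theorem MinimalDatumPFold_of :
    Summit.NavierStokesRegularity.NavierStokesRegularity.Theses.AxisymmetricExtremality.MinimalDatumPFold := by
  intro ν hν hclay N
  have hfin : Literature.Analysis.FluidPDE.rusinSverakRhoMaxPure ν < ⊤ :=
    stub_thresholdFinite_of_clayFailure ν hν hclay
  set p : ℕ := max N 2 with hp_def
  have hNp : N ≤ p := le_max_left _ _
  have h2p : 2 ≤ p := le_max_right _ _
  obtain ⟨U, G, u, x, hadm, hkato, hconc, hax⟩ := stub_axisymConcentrationBranch ν hν hclay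
  obtain ⟨lam, x₀, φ, v, g, hlam, _hφ, hmin, htend⟩ :=
    stub_concentrationNearMinimalLimit (stub_concentrationWeakLimitBlowup stub_uniformRegularity)
      ν hν hfin U G u x hadm hkato hconc
  have hne := stub_minimalDatum_not_aeZero ν v g hmin
  have hL3 : MeasureTheory.MemLp v 3 (MeasureTheory.volume : MeasureTheory.Measure (EuclideanSpace ℝ (Fin 3))) :=
    hmin.1
  -- exact axisymmetry of the data gives a.e. `R_{2π/p}`-equivariance of the extracted subsequence
  have hsym : ∀ j, ∀ᵐ y ∂(MeasureTheory.volume : MeasureTheory.Measure (EuclideanSpace ℝ (Fin 3))),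
      U (φ j) (WithLp.toLp 2 ![Real.cos (2 * Real.pi / p) * y 0 - Real.sin (2 * Real.pi / p) * y 1, Real.sin (2 * Real.pi / p) * y 0 + Real.cos (2 * Real.pi / p) * y 1, y 2]) = WithLp.toLp 2 ![Real.cos (2 * Real.pi / p) * U (φ j) y 0 - Real.sin (2 * Real.pi / p) * U (φ j) y 1, Real.sin (2 * Real.pi / p) * U (φ j) y 0 + Real.cos (2 * Real.pi / p) * U (φ j) y 1, U (φ j) y 2] :=
    fun j => Filter.Eventually.of_forall fun y => hax (φ j) (2 * Real.pi / p) y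
  obtain ⟨x₁, hx₁, hfix⟩ := stub_symmetryDefectInLimit p (fun j => U (φ j)) lam x₀ v
    (fun j => (hadm (φ j)).1) hsym hlam hL3 hne htend
  obtain ⟨u₁, g₁, hmin₁, hfix₁⟩ := stub_liftRecentre ν p h2p v g hmin x₁ hx₁ hfix
  obtain ⟨u₂, g₂, hmin₂, hsym₂⟩ := stub_liftAeToExact ν p h2p u₁ g₁ hmin₁ hfix₁
  exact ⟨p, hNp, h2p, u₂, g₂, hmin₂, hsym₂⟩

end Summit.NavierStokesRegularity.NavierStokesRegularity.Cruxes.MinimalDatumPFold.SubthresholdBranch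

end
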